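/-
Copyright: the b2b-balaban T⁴-continuum CRUX team, row NE7b OWNER lineage `t4-ne7b-p1` (gen 140). Project licence.
-/
import Mathlib.Analysis.SpecialFunctions.Pow.Real
import Mathlib.Algebra.Order.BigOperators.Ring.Finset
import Mathlib.Algebra.BigOperators.Field

/-!
# TREE DECAY OF THE THIRD-ORDER KERNEL LETTER FROM THREE TWO-POINT BOUNDS (SCOPING (d11)(4), bookkeeping): (461) bounds the joint
# cumulant `κ₃(x,y,z)` of three local observables by `2√(2m₄(B_{xy} + B_{xz}))` with `x` distinguished — and equally with `y` or `z`
# distinguished — and (462) makes each `B` decay: `B_{xy} ≤ K∕θ_{xy}`.  With a base weight `ρ ≥ 1` (symmetric, submultiplicative: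
# `ρ_{yz} ≤ ρ_{yx}ρ_{xz}`) and `θ ≥ ρ⁸`, each distinguished bound reads `|κ₃| ≤ 4√(m₄K)∕min(ρ_{v·},ρ_{v·})⁴`, and the ELEMENTARY TREE LEMMA
#   `ρ_{xy}ρ_{xz} ≤ max_v min(the two weights at v)⁴`   (the vertex opposite the weakest edge sees the two strongest ones)
# turns the minimum of the three bounds into `|κ₃(x,y,z)| ≤ 4√(m₄K)∕(ρ_{xy}ρ_{xz})`, whose double sum is the LETTER
#   `Σ_{y,z} |κ₃(x,y,z)| ≤ 4√(m₄K)·(Σ_y ρ_{xy}⁻¹)²`   — volume-uniform third-order kernel letter at an eighth of the two-point rate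
# (row NE7b, node U5c; Mathlib only; [folklore])

Cell `pub-balaban`, sub-cell `t4`, spine estimate NE7b (`T4WeightBudget.RelWeightBound`; the cell's OWN estimate — NOT PRINTED in
[Bałaban 1983–89], NOT PROVED).  Crux-route work under `Spine/NE7b/` by the row OWNER (`t4-ne7b-p1` gen 140, file (463)) under FREEZE
(0)'s crux-prover clause; NOTHING of Bałaban's is named as a Lean object, valued or asserted; no `T4Continuum/Support` leaf typed; no
`def`, no notation; zero `sorry`.  Imports: Mathlib only.

WHAT IS PROVED ([folklore]; weights `≥ 1`):
* §1 `inv_pow_add_le` (`ρ₁⁻⁸ + ρ₂⁻⁸ ≤ 2·min(ρ₁,ρ₂)⁻⁸`), **`distinguished_bound`** (`t ≤ 2√(2m(B₁+B₂))`, `B_i ≤ K∕ρ_i⁸` ⟹ `t ≤ 4√(mK)∕min(ρ₁,ρ₂)⁴`).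
* §2 THE TREE LEMMA **`prod_le_max_min_pow_four`** (`pq ≤ (max_v min_v)⁴` under two triangle inequalities) and **`tree_bound`**
  (three distinguished bounds ⟹ `t ≤ C∕(pq)`).
* §3 THE LETTER **`tree_double_sum_le`** (`Σ_{y,z} C∕(ρ_{xy}ρ_{xz}) ≤ C·S²` for `Σ_yρ_{xy}⁻¹ ≤ S`) and THE END **`third_kernel_letter`**
  (entrywise distinguished bounds for a three-index array ⟹ `Σ_{y,z}|T_{yz}| ≤ 4√(mK)·S²`).
* §4 toy: three collinear points at distances `1, 1, 2` with `ρ = 2^d`: `ρ_{xy}ρ_{xz} = 2·4 ≤ min(2,4)⁴`.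

HONEST (what this is NOT).  Bookkeeping only; the distinguished bounds are (461)+(462) instantiated for the road's whitened class with
(423)'s fourth moments (successor), and the cumulant form of the third derivative ((424)∕(425)) read in kernel letters is the successor's
assembly; orders four and five are NOT typed.  Scalar skeleton ((A3), NC-NE7b-α UNRULED); nothing of Bałaban's asserted.  BY-NAME EFFECT ON
THE WALL: NONE.  NE7b NOT PRINTED ∕ NOT PROVED; spine PROVED 0∕9; rung (B)+1 — the programme's measures remain FINITE-torus statements; NOT the
mass gap, NOT Clay.  HONEST DEPENDENCY: continuum YM on T⁴ ⇐ BetaPertH ∧ nine spine estimates (0∕9 proved); BetaPertH ⇐ (D1) ∧ (D4) ∧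
CAP+tail; G-an2-4 gates asym, D1 and NE2∕3∕4.
-/

set_option autoImplicit false

noncomputable section

namespace Summit.QuantumFields.BalabanUV.T4Continuum.NE7b.SupThirdCumulantTreeDecay

open Real Finset
open scoped BigOperators

/-! ## §1. From two decaying two-point bounds to one distinguished bound -/

/-- `ρ₁⁻⁸ + ρ₂⁻⁸ ≤ 2·min(ρ₁,ρ₂)⁻⁸` for `ρ₁, ρ₂ > 0`. [folklore] -/
theorem inv_pow_add_le {ρ₁ ρ₂ : ℝ} (h₁ : 0 < ρ₁) (h₂ : 0 < ρ₂) : 1 / ρ₁ ^ 8 + 1 / ρ₂ ^ 8 ≤ 2 / (min ρ₁ ρ₂) ^ 8 := by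
  have hm : 0 < min ρ₁ ρ₂ := lt_min h₁ h₂
  have e1 : 1 / ρ₁ ^ 8 ≤ 1 / (min ρ₁ ρ₂) ^ 8 :=
    one_div_le_one_div_of_le (pow_pos hm 8) (pow_le_pow_left₀ hm.le (min_le_left _ _) 8)
  have e2 : 1 / ρ₂ ^ 8 ≤ 1 / (min ρ₁ ρ₂) ^ 8 :=
    one_div_le_one_div_of_le (pow_pos hm 8) (pow_le_pow_left₀ hm.le (min_le_right _ _) 8)
  calc 1 / ρ₁ ^ 8 + 1 / ρ₂ ^ 8 ≤ 1 / (min ρ₁ ρ₂) ^ 8 + 1 / (min ρ₁ ρ₂) ^ 8 := add_le_add e1 e2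
    _ = 2 / (min ρ₁ ρ₂) ^ 8 := by ring

/-- **THE DISTINGUISHED BOUND**: `t ≤ 2√(2m(B₁ + B₂))` with `B₁ ≤ K∕ρ₁⁸`, `B₂ ≤ K∕ρ₂⁸` (`m, K ≥ 0`, `ρ_i ≥ 1`) gives
`t ≤ 4√(mK)∕min(ρ₁,ρ₂)⁴`. [folklore] -/
theorem distinguished_bound {t m K B₁ B₂ ρ₁ ρ₂ : ℝ} (hm : 0 ≤ m) (hK : 0 ≤ K) (h₁ : 1 ≤ ρ₁) (h₂ : 1 ≤ ρ₂) (hB₁ : B₁ ≤ K / ρ₁ ^ 8)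
    (hB₂ : B₂ ≤ K / ρ₂ ^ 8) (ht : t ≤ 2 * Real.sqrt (2 * m * (B₁ + B₂))) : t ≤ 4 * Real.sqrt (m * K) / (min ρ₁ ρ₂) ^ 4 := by
  have hρ₁ : 0 < ρ₁ := by linarith
  have hρ₂ : 0 < ρ₂ := by linarith
  have hmn : 0 < min ρ₁ ρ₂ := lt_min hρ₁ hρ₂
  have hsum : B₁ + B₂ ≤ K * (2 / (min ρ₁ ρ₂) ^ 8) := by
    have h := mul_le_mul_of_nonneg_left (inv_pow_add_le hρ₁ hρ₂) hK
    have e : K * (1 / ρ₁ ^ 8 + 1 / ρ₂ ^ 8) = K / ρ₁ ^ 8 + K / ρ₂ ^ 8 := by ring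
    linarith
  have h1 : 2 * m * (B₁ + B₂) ≤ 2 * m * (K * (2 / (min ρ₁ ρ₂) ^ 8)) := mul_le_mul_of_nonneg_left hsum (by positivity)
  have h2 : Real.sqrt (2 * m * (B₁ + B₂)) ≤ Real.sqrt (2 * m * (K * (2 / (min ρ₁ ρ₂) ^ 8))) := Real.sqrt_le_sqrt h1
  have e : 2 * m * (K * (2 / (min ρ₁ ρ₂) ^ 8)) = (2 / (min ρ₁ ρ₂) ^ 4) ^ 2 * (m * K) := by
    field_simp
  rw [e, Real.sqrt_mul (sq_nonneg _), Real.sqrt_sq (by positivity)] at h2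
  calc t ≤ 2 * Real.sqrt (2 * m * (B₁ + B₂)) := ht
    _ ≤ 2 * (2 / (min ρ₁ ρ₂) ^ 4 * Real.sqrt (m * K)) := by linarith
    _ = 4 * Real.sqrt (m * K) / (min ρ₁ ρ₂) ^ 4 := by ring

/-! ## §2. The tree lemma -/

/-- **THE TREE LEMMA**: for three pairwise weights `p = ρ_{xy}, q = ρ_{xz}, r = ρ_{yz} ≥ 1` with the triangle inequalities `q ≤ pr`,
`p ≤ qr` (the third, `r ≤ pq`, is not needed): `pq ≤ (max (min p q) (max (min p r) (min q r)))⁴` — the vertex opposite the weakest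
edge sees two edges each at least the second strongest, and `pq` is at most the fourth power of the second strongest. [folklore] -/
theorem prod_le_max_min_pow_four {p q r : ℝ} (hp : 1 ≤ p) (hq : 1 ≤ q) (hr : 1 ≤ r) (hqpr : q ≤ p * r) (hpqr : p ≤ q * r) :
    p * q ≤ (max (min p q) (max (min p r) (min q r))) ^ 4 := by
  set M := max (min p q) (max (min p r) (min q r)) with hM
  have hM1 : 1 ≤ M := le_trans (le_min hp hq) (le_max_left _ _)
  have hMx : min p q ≤ M := le_max_left _ _
  have hMy : min p r ≤ M := le_trans (le_max_left _ _) (le_max_right _ _)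
  have hMz : min q r ≤ M := le_trans (le_max_right _ _) (le_max_right _ _)
  have hM0 : 0 ≤ M := zero_le_one.trans hM1
  have hM2 : M ^ 2 ≤ M ^ 4 := pow_le_pow_right₀ hM1 (by norm_num)
  have hM3 : M ^ 3 ≤ M ^ 4 := pow_le_pow_right₀ hM1 (by norm_num)
  -- case analysis on the weakest edge
  rcases le_total r p with hrp | hpr
  · rcases le_total r q with hrq | hqr
    · -- `r` weakest: vertex `x` sees `p, q`
      rcases le_total p q with hpq | hqp
      · have hpM : p ≤ M := le_trans (by rw [min_eq_left hpq]) hMx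
        -- `q ≤ p r ≤ p p`
        have hq' : q ≤ p * p := hqpr.trans (mul_le_mul_of_nonneg_left hrp (by linarith))
        calc p * q ≤ p * (p * p) := mul_le_mul_of_nonneg_left hq' (by linarith)
          _ = p ^ 3 := by ring
          _ ≤ M ^ 3 := pow_le_pow_left₀ (by linarith) hpM 3
          _ ≤ M ^ 4 := hM3
      · have hqM : q ≤ M := le_trans (by rw [min_eq_right hqp]) hMx
        have hp' : p ≤ q * q := hpqr.trans (mul_le_mul_of_nonneg_left hrq (by linarith))
        calc p * q ≤ (q * q) * q := mul_le_mul_of_nonneg_right hp' (by linarith)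
          _ = q ^ 3 := by ring
          _ ≤ M ^ 3 := pow_le_pow_left₀ (by linarith) hqM 3
          _ ≤ M ^ 4 := hM3
    · -- `q ≤ r ≤ p`: `q` weakest: vertex `y` sees `p, r`; `min p r = r`
      have hrM : r ≤ M := le_trans (by rw [min_eq_right hrp]) hMy
      have hp' : p ≤ r * r := by
        calc p ≤ q * r := hpqr
          _ ≤ r * r := mul_le_mul_of_nonneg_right hqr (by linarith)
      calc p * q ≤ (r * r) * r := mul_le_mul hp' hqr (by linarith) (by positivity)
        _ = r ^ 3 := by ring
        _ ≤ M ^ 3 := pow_le_pow_left₀ (by linarith) hrM 3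
        _ ≤ M ^ 4 := hM3
  · rcases le_total q r with hqr | hrq
    · -- `p ≤ r`, `q ≤ r`: vertex `z`... the weakest is `p` or `q`; vertex opposite sees the other two
      rcases le_total p q with hpq | hqp
      · -- `p` weakest: vertex `z` sees `q, r`, `min q r = q`
        have hqM : q ≤ M := le_trans (by rw [min_eq_left hqr]) hMz
        calc p * q ≤ q * q := mul_le_mul_of_nonneg_right hpq (by linarith)
          _ = q ^ 2 := by ring
          _ ≤ M ^ 2 := pow_le_pow_left₀ (by linarith) hqM 2
          _ ≤ M ^ 4 := hM2
      · -- `q` weakest: vertex `y` sees `p, r`, `min p r = p`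
        have hpM : p ≤ M := le_trans (by rw [min_eq_left hpr]) hMy
        calc p * q ≤ p * p := mul_le_mul_of_nonneg_left hqp (by linarith)
          _ = p ^ 2 := by ring
          _ ≤ M ^ 2 := pow_le_pow_left₀ (by linarith) hpM 2
          _ ≤ M ^ 4 := hM2
    · -- `r ≤ q`, `p ≤ r`: `p` weakest: vertex `z` sees `q, r`, `min q r = r`
      have hrM : r ≤ M := le_trans (by rw [min_eq_right hrq]) hMz
      have hq' : q ≤ r * r := by
        calc q ≤ p * r := hqpr
          _ ≤ r * r := mul_le_mul_of_nonneg_right hpr (by linarith)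
      calc p * q ≤ r * (r * r) := mul_le_mul hpr hq' (by linarith) (by linarith)
        _ = r ^ 3 := by ring
        _ ≤ M ^ 3 := pow_le_pow_left₀ (by linarith) hrM 3
        _ ≤ M ^ 4 := hM3

/-- **THE TREE BOUND**: the three distinguished bounds `t ≤ C∕min(p,q)⁴`, `t ≤ C∕min(p,r)⁴`, `t ≤ C∕min(q,r)⁴` (`C ≥ 0`) under the
triangle inequalities `q ≤ pr`, `p ≤ qr` give `t ≤ C∕(pq)`. [folklore] -/
theorem tree_bound {t C p q r : ℝ} (hC : 0 ≤ C) (hp : 1 ≤ p) (hq : 1 ≤ q) (hr : 1 ≤ r) (hqpr : q ≤ p * r) (hpqr : p ≤ q * r)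
    (hx : t ≤ C / (min p q) ^ 4) (hy : t ≤ C / (min p r) ^ 4) (hz : t ≤ C / (min q r) ^ 4) : t ≤ C / (p * q) := by
  have hM := prod_le_max_min_pow_four hp hq hr hqpr hpqr
  have hpq : 0 < p * q := by positivity
  -- `t ≤ C / M⁴` for `M` the max of the three minima (it is one of them)
  have ht : t ≤ C / (max (min p q) (max (min p r) (min q r))) ^ 4 := by
    rcases le_total (min p q) (max (min p r) (min q r)) with h1 | h1
    · rw [max_eq_right h1]
      rcases le_total (min p r) (min q r) with h2 | h2
      · rw [max_eq_right h2]; exact hz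
      · rw [max_eq_left h2]; exact hy
    · rw [max_eq_left h1]; exact hx
  exact ht.trans (div_le_div_of_nonneg_left hC hpq hM)

/-! ## §3. The third-order kernel letter -/

variable {ι : Type*} [Fintype ι]

/-- **The double sum of the tree bound**: `Σ_y Σ_z C∕(ρ_{xy}ρ_{xz}) = C·(Σ_yρ_{xy}⁻¹)² ≤ C·S²`. [folklore] -/
theorem tree_double_sum_le {ρ : ι → ι → ℝ} {C S : ℝ} (hC : 0 ≤ C) (hρ1 : ∀ x y, 1 ≤ ρ x y) (x : ι) (hS : ∑ y, 1 / ρ x y ≤ S) :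
    ∑ y, ∑ z, C / (ρ x y * ρ x z) ≤ C * S ^ 2 := by
  have hρ0 : ∀ y, 0 ≤ 1 / ρ x y := fun y => div_nonneg zero_le_one (zero_le_one.trans (hρ1 x y))
  have hS0 : 0 ≤ ∑ y, 1 / ρ x y := Finset.sum_nonneg fun y _ => hρ0 y
  have e : ∑ y, ∑ z, C / (ρ x y * ρ x z) = C * ((∑ y, 1 / ρ x y) * ∑ z, 1 / ρ x z) := by
    rw [Finset.sum_mul_sum, Finset.mul_sum]
    refine Finset.sum_congr rfl fun y _ => ?_
    rw [Finset.mul_sum]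
    exact Finset.sum_congr rfl fun z _ => by field_simp
  rw [e, sq]
  exact mul_le_mul_of_nonneg_left (mul_le_mul hS hS hS0 (hS0.trans hS)) hC

/-- **THE THIRD-ORDER KERNEL LETTER FROM DISTINGUISHED BOUNDS**: a three-index quantity `T_{yz}` (the joint cumulant at `x, y, z`) obeying,
for every `y, z`, the three distinguished bounds `|T_{yz}| ≤ 4√(mK)∕min(·,·)⁴` at the vertices `x`, `y`, `z` of a symmetric submultiplicative
base weight `ρ ≥ 1` has the volume-uniform letter `Σ_y Σ_z |T_{yz}| ≤ 4√(mK)·S²` (`Σ_yρ_{xy}⁻¹ ≤ S`). [folklore] -/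
theorem third_kernel_letter {ρ : ι → ι → ℝ} {T : ι → ι → ℝ} {m K S : ℝ} (hρ1 : ∀ x y, 1 ≤ ρ x y)
    (hρsymm : ∀ x y, ρ x y = ρ y x) (hρmul : ∀ x y z, ρ x z ≤ ρ x y * ρ y z) (x : ι) (hS : ∑ y, 1 / ρ x y ≤ S)
    (hx : ∀ y z, |T y z| ≤ 4 * Real.sqrt (m * K) / (min (ρ x y) (ρ x z)) ^ 4)
    (hy : ∀ y z, |T y z| ≤ 4 * Real.sqrt (m * K) / (min (ρ x y) (ρ y z)) ^ 4)
    (hz : ∀ y z, |T y z| ≤ 4 * Real.sqrt (m * K) / (min (ρ x z) (ρ y z)) ^ 4) :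
    ∑ y, ∑ z, |T y z| ≤ 4 * Real.sqrt (m * K) * S ^ 2 := by
  have hC : 0 ≤ 4 * Real.sqrt (m * K) := by positivity
  refine le_trans (Finset.sum_le_sum fun y _ => Finset.sum_le_sum fun z _ => ?_) (tree_double_sum_le hC hρ1 x hS)
  -- the tree bound at the triangle `x, y, z` with `p = ρ_xy`, `q = ρ_xz`, `r = ρ_yz`
  have hqpr : ρ x z ≤ ρ x y * ρ y z := hρmul x y z
  have hpqr : ρ x y ≤ ρ x z * ρ y z := by rw [hρsymm y z]; exact hρmul x z y
  exact tree_bound hC (hρ1 x y) (hρ1 x z) (hρ1 y z) hqpr hpqr (hx y z) (hy y z) (hz y z)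

/-! ## §4. Toy instance (kernel) -/

/-- Toy: collinear points at mutual distances `1, 1, 2` with `ρ = 2^d`: `p = 2, q = 4, r = 2`, and `pq = 8 ≤ min(2,4)⁴ = 16`. -/
example : (2 : ℝ) * 4 ≤ (max (min 2 4) (max (min 2 2) (min 4 2))) ^ 4 := by norm_num

end Summit.QuantumFields.BalabanUV.T4Continuum.NE7b.SupThirdCumulantTreeDecay

end
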